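import Mathlib
import Literature.NumberTheory.Transcendental.KZCalculus
import Literature.NumberTheory.Transcendental.MZVSimplexRep
import Summits.KontsevichZagierPeriods.KontsevichZagierPeriods.Theses.LinRedNormalForm

/-!
# Sketch — crux-ideate round 2 (ideator 5), crux `LinRedNormalForm.DihedralNormalForm`

First-lemma signatures for the idea cards
* `torus-descent-sum-shadow` : `TorusDescent`, `EulerCompact`, `AtomShift`
* `tame-bv-stokes`          : `BVStokes`, `BoundedStokesMove`

Nothing is proved here; the point is that the statements elaborate over existing declarations.
-/

noncomputable section

open MeasureTheory Set

namespace Summit.KontsevichZagierPeriods.KontsevichZagierPeriods.Cruxes.DihedralNormalForm.IdeateR2K5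

open Literature.NumberTheory.Transcendental

/-- The open unit cube `(0,1)^k` (definitionally the shape used by route item `BeukersZeta3`). -/
def cube (k : ℕ) : Set (Fin k → ℝ) := {x | ∀ i, x i ∈ Set.Ioo (0:ℝ) 1}

/-- The chord monomial `x_i x_{i+1} ⋯ x_j` of Brown's cubical coordinates (ENS 2009, (7.8)). -/
def chordMono {k : ℕ} (i j : Fin k) (x : Fin k → ℝ) : ℝ :=
  ∏ l, if i ≤ l ∧ l ≤ j then x l else 1

/-- Brown's cubical ATOM `x^a (1-x)^b / ∏_{i<j} (1 - x_i⋯x_j)^{c_ij}` (ENS 2009, Lemma 7.2 (7.8));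
for exponents coming from `α ≥ 0` via (7.9) it is absolutely integrable on the cube (Lemma 7.4). -/
def atom (k : ℕ) (a b : Fin k → ℕ) (c : Fin k → Fin k → ℕ) (x : Fin k → ℝ) : ℝ :=
  (∏ i, x i ^ a i) * (∏ i, (1 - x i) ^ b i) /
    ∏ i, ∏ j, if i < j then (1 - chordMono i j x) ^ c i j else 1

/-- **Card `torus-descent-sum-shadow`, first lemma (TorusDescent).** A convergent representation
on the open cube whose integrand is homogeneous of degree `κ` for the one-parameter torus
`x ↦ t^λ · x` descends, by ONE monomial change of variables straightening `λ` (rule 2), a null-set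
domain additivity (rule 1a) and ONE Newton–Leibniz move along the orbit parameter with the
RATIONAL primitive `t^e · g / e`, `e = κ + Σ λ_i ≠ 0` (rule 3), to a representation of one
dimension less; the base is automatically absolutely convergent (fibrewise triangle inequality).
For an atom, `λ ⊥ 1_I` for every chord `I` makes it homogeneous with `κ = ⟨λ, a⟩`; the excluded
case `e = 0` is exactly the torus-INVARIANT form whose orbit primitive is a logarithm
(the disprover's `no_semialgebraic_primitive_letter_one`). -/
def TorusDescent : Prop :=
  ∀ (k : ℕ) (lam : Fin (k + 1) → ℤ) (κ : ℤ) (r : KZ.IntegralRep (k + 1)),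
    lam ≠ 0 →
    r.domain = cube (k + 1) →
    (∀ x ∈ r.domain, ∀ t : ℝ, 0 < t → (fun i => t ^ (lam i) * x i) ∈ r.domain →
        r.integrand (fun i => t ^ (lam i) * x i) = t ^ κ * r.integrand x) →
    (κ + ∑ i, lam i ≠ 0) →
    ∃ s : KZ.IntegralRep k, KZ.Equivalent r s

/-- **Card `torus-descent-sum-shadow`, second lemma (EulerCompact): the always-legal,
boundary-free torus IBP.** For every atom `g` on the open cube and every direction `i`, the
derivative `∂_i (x_i (1 - x_i) g)` is again absolutely integrable (every term is dominated by
`|g|`, using `(1 - x_i) x^I / (1 - x^I) ≤ 1` for `i ∈ I`) and its representation is a relation: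
Newton–Leibniz along `x_i` (after a coordinate permutation) with primitive `x_i (1 - x_i) g`
vanishing at both fibre ends, base = zero integrand. These are the GKZ Euler operators of the
Euler–Mellin presentation `x = y/(1+y)` of the atom, the only hypergeometric relations that survive
at the singular unit point. -/
def EulerCompact : Prop :=
  ∀ (k : ℕ) (i : Fin (k + 1)) (a b : Fin (k + 1) → ℕ) (c : Fin (k + 1) → Fin (k + 1) → ℕ)
    (r : KZ.IntegralRep (k + 1)),
    r.domain = cube (k + 1) → Set.EqOn r.integrand (atom (k + 1) a b c) r.domain →
    ∃ r₁ : KZ.IntegralRep (k + 1), r₁.domain = cube (k + 1) ∧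
      Set.EqOn r₁.integrand (fun x => atom (k + 1) a b c x *
        ((1 - 2 * x i) + (a i : ℝ) * (1 - x i) - (b i : ℝ) * x i
          + ∑ j, ∑ j', if j ≤ i ∧ i ≤ j' ∧ j < j' then
              (c j j' : ℝ) * (1 - x i) * chordMono j j' x / (1 - chordMono j j' x) else 0))
        r₁.domain ∧
      KZ.of r₁ ∈ KZ.relations

/-- **Card `torus-descent-sum-shadow`, third lemma (AtomShift = word ↔ zeta-star change of basis).**
If the monomial covers a chord, `a ≥ 1_{[i,j]}`, `c_ij ≥ 1`, then peeling it is ONE legal integrand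
additivity `x^{1_I} g / K_I = g / K_I - g` between three convergent atoms. -/
def AtomShift : Prop :=
  ∀ (k : ℕ) (i j : Fin k) (a b : Fin k → ℕ) (c : Fin k → Fin k → ℕ) (r : KZ.IntegralRep k),
    i < j → 1 ≤ c i j → (∀ l, i ≤ l → l ≤ j → 1 ≤ a l) →
    r.domain = cube k → Set.EqOn r.integrand (atom k a b c) r.domain →
    ∃ r₁ r₂ : KZ.IntegralRep k,
      r₁.domain = cube k ∧ r₂.domain = cube k ∧
      Set.EqOn r₁.integrand
        (atom k (fun l => if i ≤ l ∧ l ≤ j then a l - 1 else a l) b c) r₁.domain ∧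
      Set.EqOn r₂.integrand
        (atom k (fun l => if i ≤ l ∧ l ≤ j then a l - 1 else a l) b
          (fun p q => if p = i ∧ q = j then c p q - 1 else c p q)) r₂.domain ∧
      KZ.of r - KZ.of r₁ + KZ.of r₂ ∈ KZ.relations

/-- **Card `tame-bv-stokes`, first lemma (BVStokes): tameness makes coordinate Stokes pieces
absolutely convergent.** A BOUNDED `ℚ`-semialgebraic function, differentiable on the open cube, has
absolutely integrable partial derivatives: along each coordinate fibre the number of sign changes of
`∂_i h` is uniformly bounded (o-minimal uniform finiteness), so the fibre's total variation is at most
`2 M sup |h|`. (W3 of TRIAGE-r1-3 fails exactly because its primitive is unbounded at the corner.) -/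
def BVStokes : Prop :=
  ∀ (k : ℕ) (i : Fin (k + 1)) (h : (Fin (k + 1) → ℝ) → ℝ) (C : ℝ),
    IsSemialgebraicFunOn ℚ (cube (k + 1)) h →
    (∀ x ∈ cube (k + 1), |h x| ≤ C) →
    (∀ x ∈ cube (k + 1), DifferentiableAt ℝ h x) →
    MeasureTheory.IntegrableOn (fun x => fderiv ℝ h x (Pi.single i 1)) (cube (k + 1))

/-- **Card `tame-bv-stokes`, move form (BoundedStokesMove).** For bounded semialgebraic
coefficients `h_i` (continuous up to the closed cube along each coordinate fibre), Stokes for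
`η = Σ (-1)^i h_i dx^{(i)}` splits into `k+1` legal Newton–Leibniz moves: the representation of
`Σ_i ∂_i h_i` on the cube is congruent to the signed sum of the `2(k+1)` face representations. -/
def BoundedStokesMove : Prop :=
  ∀ (k : ℕ) (h : Fin (k + 1) → (Fin (k + 1) → ℝ) → ℝ) (C : ℝ)
    (r : KZ.IntegralRep (k + 1)) (f₀ f₁ : Fin (k + 1) → KZ.IntegralRep k),
    (∀ i, IsSemialgebraicFunOn ℚ (cube (k + 1)) (h i)) →
    (∀ i, ∀ x ∈ cube (k + 1), |h i x| ≤ C) →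
    (∀ i, ∀ x ∈ cube (k + 1), DifferentiableAt ℝ (h i) x) →
    (∀ i, ∀ y ∈ cube k, ContinuousOn (fun t : ℝ => h i (Fin.insertNth i t y)) (Set.Icc 0 1)) →
    r.domain = cube (k + 1) →
    Set.EqOn r.integrand (fun x => ∑ i, fderiv ℝ (h i) x (Pi.single i 1)) r.domain →
    (∀ i, (f₀ i).domain = cube k ∧ (f₁ i).domain = cube k ∧
      Set.EqOn (f₀ i).integrand (fun y => h i (Fin.insertNth i 0 y)) (cube k) ∧
      Set.EqOn (f₁ i).integrand (fun y => h i (Fin.insertNth i 1 y)) (cube k)) →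
    KZ.of r - ∑ i, (KZ.of (f₁ i) - KZ.of (f₀ i)) ∈ KZ.relations

end Summit.KontsevichZagierPeriods.KontsevichZagierPeriods.Cruxes.DihedralNormalForm.IdeateR2K5
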